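import Summits.Ventures.YMGap.Census.TwistCensusDegree
import Summits.Ventures.YMGap.Census.TwistCensusSheets
import HarnessLib

/-!
# Venture YMGap, track (b) census — the cosheets: the top coefficient of the census polynomial is `|𝒱ᵢⱼ|` copies of ONE Haar moment

HONEST FRAMING: venture file of the cell `pub-ymgap` (QuantumFields programme), track (b).  Exact statements about
the one-character census polynomials of `Census/TwistCensusObjects.lean` on a rectangular torus (any `d`, every side
`≥ 1`); NO sign of any Haar moment is decided here; nothing about root locations, limits or physics.

`Census/TwistCensusDegree.lean` (engine-1) proves `deg Nᵢⱼ ≤ 2|Λ₂| − 1 − P` (`P := LᵢLⱼ`) and identifies the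
coefficient in that degree as `2·P·(−1)^{|𝒱|} · cosheetMomentSum · (2^{|Λ₂|} I(Λ₂))`,
`cosheetMomentSum := Σ_{|T| = P, |T ∩ 𝒱| odd} 2^{|Λ₂|−P} I(Λ₂ ∖ T)`, so that the degree law (D) and the leading-sign law
(S∞) of the typed census conjecture are together EQUIVALENT to `0 < cosheetMomentSum · I(Λ₂)`.  This file evaluates
the cosheet sum with the identification theorem of `Census/TwistCensusSheets.lean` (lit-2):

* `even_card_rectCoboundary` : every link coboundary `δE` has an EVEN number of plaquettes (the boundary-slot count
  summed over all plaquettes is even: the slots `(x, a)`/`(x + e_b, a)` and `(x, b)`/`(x + e_a, b)` are exchanged by a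
  translation of the base point); hence `even_inter_rectCoboundary_compl`: the complement of a mod-2 cycle is a mod-2
  cycle, and `eq_flatSheet_of_rectCharMoment_compl_ne_zero`: **if `|T| = P`, `|T ∩ 𝒱ᵢⱼ|` is odd and `I(Λ₂ ∖ T) ≠ 0`
  then `T` is a flat `(i, j)`-sheet**;
* `cosheetMomentSum_eq_sum_rectVortexSheet` : `cosheetMomentSum = Σ_{q ∈ 𝒱ᵢⱼ} 2^{|Λ₂|−P} I(Λ₂ ∖ flatSheet q)`;
* translations: `edgeTranslate` / `plaqTranslate`, `rectCharMoment_map_plaqTranslate` (**the Haar moment is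
  translation invariant**, relabelling of the product Haar measure), `flatSheet_map_plaqTranslate`, hence
  `rectCharMoment_compl_flatSheet_eq` : `I(Λ₂ ∖ flatSheet y)` does not depend on `y`;
* ★ `cosheetMomentSum_eq_card_mul` : **`cosheetMomentSum = |𝒱ᵢⱼ| · 2^{|Λ₂|−P} · I(Λ₂ ∖ Π)`** for ANY flat
  `(i, j)`-sheet `Π = flatSheet y₀`, and ★ `cosheetMomentSum_mul_pos_iff` :
  **`0 < cosheetMomentSum · I(Λ₂) ↔ 0 < I(Λ₂ ∖ Π) · I(Λ₂)`** — after `TwistCensusGermLaw` ((G) a theorem) the typed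
  conjecture `Conjectures.TwistCensusParity` is thereby reduced (via engine-1's `TwistCensusParityReductions`) to the
  SIGN of the product of two explicit Haar integrals per plane: the full one-character moment `I(Λ₂)` of the 3-torus and
  the moment `I(Λ₂ ∖ Π)` of the complement of one coordinate plane.  Neither sign is decided here.

References: E. T. Tomboulis, arXiv:0707.2179 §6.2 p. 18 (minimal polymers Π and their number ∏_{κ≠1,2} L_κ)
[cite: Tomboulis2007Confinement, §6.2 p. 18]; HOME/STRUCTURE.md §4 N-3 (ii); HOME/engine/census/TwistCensusParity/
(evidence: (D) 127/127, (S∞) 127/127 rows).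
-/

noncomputable section

open MeasureTheory Finset Real Function
open scoped BigOperators
open Literature.MathematicalPhysics.QuantumLattice
open Literature.MathematicalPhysics.QuantumFieldTheory
open Literature.MathematicalPhysics.QuantumFieldTheory.Tomboulis2007

namespace Summit.Ventures.YMGap.Census

variable {d : ℕ} (Ls : Fin d → ℕ) [∀ i, NeZero (Ls i)]

/-! ### Every link coboundary is even; complements of mod-2 cycles are mod-2 cycles -/

/-- Shifting the base point of a plaquette by the unit vector of a direction read off its plane tag (an equivalence of
the plaquettes; plumbing for the slot-exchange argument). -/
def plaqSlotShift (f : {p : Fin d × Fin d // p.1 < p.2} → Fin d) : RectPlaquette Ls ≃ RectPlaquette Ls where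
  toFun p := (p.1 + Pi.single (f p.2) 1, p.2)
  invFun p := (p.1 - Pi.single (f p.2) 1, p.2)
  left_inv p := by simp
  right_inv p := by simp

/-- **The boundary-slot counts of a link set sum to an even number over all plaquettes**: the slot `(x + e_b, a)` of the
plaquette at `x` is the slot `(x', a)` of the plaquette at `x' = x + e_b`, and likewise `(x + e_a, b)` / `(x', b)`. -/
theorem even_sum_rectFlipCount (E : Finset (RectEdge Ls)) :
    Even (∑ p : RectPlaquette Ls, rectFlipCount E p.1 p.2.1.1 p.2.1.2) := by
  have h3 : ∑ p : RectPlaquette Ls, rectLinkInd E (p.1 + Pi.single p.2.1.2 1, p.2.1.1) =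
      ∑ p : RectPlaquette Ls, rectLinkInd E (p.1, p.2.1.1) :=
    Equiv.sum_comp (plaqSlotShift Ls fun q => q.1.2) (fun p : RectPlaquette Ls => rectLinkInd E (p.1, p.2.1.1))
  have h2 : ∑ p : RectPlaquette Ls, rectLinkInd E (p.1 + Pi.single p.2.1.1 1, p.2.1.2) =
      ∑ p : RectPlaquette Ls, rectLinkInd E (p.1, p.2.1.2) :=
    Equiv.sum_comp (plaqSlotShift Ls fun q => q.1.1) (fun p : RectPlaquette Ls => rectLinkInd E (p.1, p.2.1.2))
  simp only [rectFlipCount, Finset.sum_add_distrib, h3, h2]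
  refine ⟨∑ p : RectPlaquette Ls, rectLinkInd E (p.1, p.2.1.1) + ∑ p : RectPlaquette Ls, rectLinkInd E (p.1, p.2.1.2), ?_⟩
  ring

/-- **Every link coboundary has an even number of plaquettes.** [folklore] -/
theorem even_card_rectCoboundary (E : Finset (RectEdge Ls)) : Even (rectCoboundary E).card := by
  have h := even_sum_rectFlipCount Ls E
  rw [← ZMod.natCast_eq_zero_iff_even, Nat.cast_sum] at h
  rw [← ZMod.natCast_eq_zero_iff_even]
  have hcast : ∀ p : RectPlaquette Ls, ((rectFlipCount E p.1 p.2.1.1 p.2.1.2 : ℕ) : ZMod 2) =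
      if Odd (rectFlipCount E p.1 p.2.1.1 p.2.1.2) then 1 else 0 := by
    intro p
    split_ifs with ho
    · rcases ho with ⟨m, hm⟩
      rw [hm, Nat.cast_add, Nat.cast_mul, Nat.cast_two, Nat.cast_one,
        show (2 : ZMod 2) = 0 from rfl, zero_mul, zero_add]
    · rw [ZMod.natCast_eq_zero_iff_even]
      exact Nat.not_odd_iff_even.mp ho
  simp only [hcast, Finset.sum_boole] at h
  rwa [show (univ.filter fun p : RectPlaquette Ls => Odd (rectFlipCount E p.1 p.2.1.1 p.2.1.2)) = rectCoboundary E
    from rfl] at h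

/-- **The complement of a mod-2 cycle is a mod-2 cycle**: if `S` meets every coboundary evenly then so does `Λ₂ ∖ S`. -/
theorem even_inter_rectCoboundary_compl {S : Finset (RectPlaquette Ls)}
    (hev : ∀ E : Finset (RectEdge Ls), Even (S ∩ rectCoboundary E).card) (E : Finset (RectEdge Ls)) :
    Even ((univ \ S) ∩ rectCoboundary E).card := by
  have h1 : (univ \ S) ∩ rectCoboundary E = rectCoboundary E \ (S ∩ rectCoboundary E) := by
    ext p
    simp only [Finset.mem_inter, Finset.mem_sdiff, Finset.mem_univ, true_and]
    tauto
  rw [h1, Finset.card_sdiff_of_subset Finset.inter_subset_right]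
  exact (Nat.even_sub (Finset.card_le_card Finset.inter_subset_right)).2 (iff_of_true (even_card_rectCoboundary Ls E) (hev E))

variable {i j : Fin d} (hij : i < j)

/-- **IDENTIFICATION for the top end**: a plaquette set `T` with `|T| = LᵢLⱼ`, `|T ∩ 𝒱ᵢⱼ|` odd and `I(Λ₂ ∖ T) ≠ 0` is a
flat `(i, j)`-sheet (support rule for `Λ₂ ∖ T` + `even_inter_rectCoboundary_compl` + `eq_flatSheet_of_even`). -/
theorem eq_flatSheet_of_rectCharMoment_compl_ne_zero {T : Finset (RectPlaquette Ls)} (hcard : T.card = Ls i * Ls j)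
    (hodd : Odd (T ∩ rectVortexSheet Ls i j hij).card) (hT : rectCharMoment Ls (univ \ T) ≠ 0) :
    ∃ q ∈ rectVortexSheet Ls i j hij, T = flatSheet Ls hij q.1 := by
  refine eq_flatSheet_of_even Ls hij hcard hodd fun E => ?_
  have h := even_inter_rectCoboundary_compl Ls
    (fun E' => even_inter_rectCoboundary_of_rectCharMoment_ne_zero Ls hT E') E
  rwa [sdiff_sdiff_right_self, Finset.inf_eq_inter, Finset.univ_inter] at h

/-- **The cosheet moment sum is the sum over the flat sheets**:
`cosheetMomentSum = Σ_{q ∈ 𝒱ᵢⱼ} 2^{|Λ₂|−LᵢLⱼ} I(Λ₂ ∖ flatSheet q)`. -/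
theorem cosheetMomentSum_eq_sum_rectVortexSheet :
    cosheetMomentSum Ls hij = ∑ q ∈ rectVortexSheet Ls i j hij,
      (2 : ℝ) ^ (Fintype.card (RectPlaquette Ls) - Ls i * Ls j) * rectCharMoment Ls (univ \ flatSheet Ls hij q.1) := by
  unfold cosheetMomentSum
  rw [← Finset.sum_image (f := fun T => (2 : ℝ) ^ (Fintype.card (RectPlaquette Ls) - Ls i * Ls j) *
    rectCharMoment Ls (univ \ T)) (flatSheet_injOn Ls hij)]
  symm
  apply Finset.sum_subset
  · intro T hT
    obtain ⟨q, hq, rfl⟩ := Finset.mem_image.1 hT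
    rw [Finset.mem_filter, Finset.mem_powerset]
    refine ⟨Finset.subset_univ _, card_flatSheet Ls hij q.1, ?_⟩
    rw [flatSheet_inter_rectVortexSheet Ls hij hq, Finset.card_singleton]
    exact odd_one
  · intro T hT hT'
    rw [Finset.mem_filter] at hT
    by_contra h
    have hI : rectCharMoment Ls (univ \ T) ≠ 0 := fun h0 => h (by rw [h0, mul_zero])
    obtain ⟨q, hq, rfl⟩ := eq_flatSheet_of_rectCharMoment_compl_ne_zero Ls hij hT.2.1 hT.2.2 hI
    exact hT' (Finset.mem_image.2 ⟨q, hq, rfl⟩)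

/-! ### Translations: the Haar moment is translation invariant -/

/-- Translating the base point of a link by `v`. -/
def edgeTranslate (v : RectTorusSite Ls) : RectEdge Ls ≃ RectEdge Ls where
  toFun e := (e.1 + v, e.2)
  invFun e := (e.1 - v, e.2)
  left_inv e := by simp
  right_inv e := by simp

/-- Translating the base point of a plaquette by `v`. -/
def plaqTranslate (v : RectTorusSite Ls) : RectPlaquette Ls ≃ RectPlaquette Ls where
  toFun p := (p.1 + v, p.2)
  invFun p := (p.1 - v, p.2)
  left_inv p := by simp
  right_inv p := by simp

omit [∀ i, NeZero (Ls i)] in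
/-- The holonomy of the translated configuration is the holonomy at the translated base point. -/
theorem rectPlaquetteHolonomy_comp_edgeTranslate (v : RectTorusSite Ls) (V : RectGaugeConfig Ls SU2)
    (x : RectTorusSite Ls) (a b : Fin d) :
    rectPlaquetteHolonomy (fun e => V (edgeTranslate Ls v e)) x a b = rectPlaquetteHolonomy V (x + v) a b := by
  simp only [rectPlaquetteHolonomy, edgeTranslate, Equiv.coe_fn_mk]
  rw [add_right_comm x (Pi.single a 1) v, add_right_comm x (Pi.single b 1) v]

omit [∀ i, NeZero (Ls i)] in
/-- The plaquette character of the translated configuration is the character of the translated plaquette. -/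
theorem rectPlaqChar_comp_edgeTranslate (v : RectTorusSite Ls) (V : RectGaugeConfig Ls SU2) (p : RectPlaquette Ls) :
    rectPlaqChar (fun e => V (edgeTranslate Ls v e)) p = rectPlaqChar V (plaqTranslate Ls v p) := by
  simp only [rectPlaqChar, plaqTranslate, Equiv.coe_fn_mk, rectPlaquetteHolonomy_comp_edgeTranslate]

/-- Relabelling invariance of the product Haar integral: `∫ F(V ∘ σ) dV = ∫ F(V) dV` for a permutation `σ` of the links
(`MeasureTheory.measurePreserving_piCongrLeft`; the pattern of `Literature.…HeterogeneousCyclicPeeling.integral_pi_comp_perm`).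
[folklore] -/
theorem integral_pi_comp_edgePerm (σ : RectEdge Ls ≃ RectEdge Ls) (F : RectGaugeConfig Ls SU2 → ℝ) :
    ∫ V, F (fun e => V (σ e)) ∂(Measure.pi fun _ : RectEdge Ls => haarProbability SU2) =
      ∫ V, F V ∂(Measure.pi fun _ : RectEdge Ls => haarProbability SU2) := by
  have h := measurePreserving_piCongrLeft (fun _ : RectEdge Ls => haarProbability SU2) σ.symm
  have he : ∀ V : RectGaugeConfig Ls SU2,
      (MeasurableEquiv.piCongrLeft (fun _ : RectEdge Ls => SU2) σ.symm V) = fun e => V (σ e) := fun V => by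
    funext e
    simp only [MeasurableEquiv.coe_piCongrLeft, Equiv.piCongrLeft_apply_eq_cast, cast_eq, Equiv.symm_symm]
  calc ∫ V, F (fun e => V (σ e)) ∂(Measure.pi fun _ : RectEdge Ls => haarProbability SU2)
      = ∫ V, F (MeasurableEquiv.piCongrLeft (fun _ : RectEdge Ls => SU2) σ.symm V)
          ∂(Measure.pi fun _ : RectEdge Ls => haarProbability SU2) := by simp only [he]
    _ = ∫ V, F V ∂(Measure.pi fun _ : RectEdge Ls => haarProbability SU2) := h.integral_comp' F

/-- **The Haar moment is translation invariant**: `I(S + v) = I(S)`. -/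
theorem rectCharMoment_map_plaqTranslate (v : RectTorusSite Ls) (S : Finset (RectPlaquette Ls)) :
    rectCharMoment Ls (S.map (plaqTranslate Ls v).toEmbedding) = rectCharMoment Ls S := by
  unfold rectCharMoment
  rw [← integral_pi_comp_edgePerm Ls (edgeTranslate Ls v) (fun V => ∏ p ∈ S, rectPlaqChar V p)]
  refine integral_congr_ae (ae_of_all _ fun V => ?_)
  beta_reduce
  rw [Finset.prod_map]
  exact Finset.prod_congr rfl fun p _ => (rectPlaqChar_comp_edgeTranslate Ls v V p).symm

/-- Translating a flat sheet translates its transverse position. -/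
theorem flatSheet_map_plaqTranslate (y v : RectTorusSite Ls) :
    (flatSheet Ls hij y).map (plaqTranslate Ls v).toEmbedding = flatSheet Ls hij (y + v) := by
  ext p
  rw [Finset.mem_map_equiv, mem_flatSheet, mem_flatSheet]
  simp only [plaqTranslate, Equiv.coe_fn_symm_mk, Pi.sub_apply, Pi.add_apply, sub_eq_iff_eq_add]

/-- Translating the complement of a flat sheet. -/
theorem compl_flatSheet_map_plaqTranslate (y v : RectTorusSite Ls) :
    (univ \ flatSheet Ls hij y).map (plaqTranslate Ls v).toEmbedding = univ \ flatSheet Ls hij (y + v) := by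
  rw [← flatSheet_map_plaqTranslate Ls hij y v]
  ext p
  simp only [Finset.mem_map_equiv, Finset.mem_sdiff, Finset.mem_univ, true_and]

/-- **`I(Λ₂ ∖ flatSheet y)` does not depend on the position `y` of the sheet.** -/
theorem rectCharMoment_compl_flatSheet_eq (y y' : RectTorusSite Ls) :
    rectCharMoment Ls (univ \ flatSheet Ls hij y) = rectCharMoment Ls (univ \ flatSheet Ls hij y') := by
  rw [← rectCharMoment_map_plaqTranslate Ls (y' - y) (univ \ flatSheet Ls hij y), compl_flatSheet_map_plaqTranslate,
    add_sub_cancel]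

/-! ### The cosheet sum is `|𝒱ᵢⱼ|` copies of one moment -/

/-- ★ **`cosheetMomentSum = |𝒱ᵢⱼ| · 2^{|Λ₂|−LᵢLⱼ} · I(Λ₂ ∖ Π)`** for any flat `(i, j)`-sheet `Π = flatSheet y₀`. -/
theorem cosheetMomentSum_eq_card_mul (y₀ : RectTorusSite Ls) :
    cosheetMomentSum Ls hij = ((rectVortexSheet Ls i j hij).card : ℝ) *
      ((2 : ℝ) ^ (Fintype.card (RectPlaquette Ls) - Ls i * Ls j) * rectCharMoment Ls (univ \ flatSheet Ls hij y₀)) := by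
  rw [cosheetMomentSum_eq_sum_rectVortexSheet,
    Finset.sum_congr rfl fun q _ => by rw [rectCharMoment_compl_flatSheet_eq Ls hij q.1 y₀], Finset.sum_const,
    nsmul_eq_mul]

/-- **`LᵢLⱼ · |𝒱ᵢⱼ| = ∏_k L_k`** (every `d`): the `(i, j)`-plaquettes — one per site — split into the `LᵢLⱼ` parallel
stacks, all of the size of the twist stack (`TwistCensusDegree.card_stackAt`); so `|𝒱ᵢⱼ| = ∏_{k ≠ i, j} L_k`. -/
theorem mul_card_rectVortexSheet : Ls i * Ls j * (rectVortexSheet Ls i j hij).card = ∏ k, Ls k := by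
  have h1 : (planePlaquettes Ls hij).card = ∏ k, Ls k := by
    have hpl : planePlaquettes Ls hij =
        (univ : Finset (RectTorusSite Ls)).map ⟨fun x => ((x, ⟨(i, j), hij⟩) : RectPlaquette Ls),
          fun x x' h => congrArg Prod.fst h⟩ := by
      ext p
      simp only [planePlaquettes, Finset.mem_filter, Finset.mem_univ, true_and, Finset.mem_map,
        Function.Embedding.coeFn_mk]
      constructor
      · intro h
        refine ⟨p.1, ?_⟩
        rw [← h]
      · rintro ⟨x, rfl⟩
        rfl
    rw [hpl, Finset.card_map, Finset.card_univ, Fintype.card_pi]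
    exact Finset.prod_congr rfl fun k _ => ZMod.card (Ls k)
  have h2 := card_inter_planePlaquettes_eq_sum Ls hij (univ : Finset (RectPlaquette Ls))
  simp_rw [Finset.univ_inter, card_stackAt Ls hij, Finset.sum_const, Finset.card_univ, Fintype.card_prod, ZMod.card,
    smul_eq_mul] at h2
  rw [← h1, h2, rectVortexSheet_eq_stackAt]

/-- The twist stack is never empty: it contains the plaquette at the origin. -/
theorem origin_mem_rectVortexSheet : ((0 : RectTorusSite Ls), ⟨(i, j), hij⟩) ∈ rectVortexSheet Ls i j hij := by
  rw [rectVortexSheet_eq_stackAt, mem_stackAt]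
  exact ⟨rfl, rfl, rfl⟩

/-- ★ **The residual of the typed census conjecture, per plane, is the sign of ONE product of two Haar moments**:
`0 < cosheetMomentSum · I(Λ₂) ↔ 0 < I(Λ₂ ∖ Π) · I(Λ₂)` for any flat `(i, j)`-sheet `Π = flatSheet y₀` (with engine-1's
`TwistCensusDegree` / `TwistCensusParityReductions`: (D) ∧ (S∞) ⟺ the left side; after `TwistCensusGermLaw` (G) is a
theorem).  Neither moment's sign is decided here. -/
theorem cosheetMomentSum_mul_pos_iff (y₀ : RectTorusSite Ls) :
    0 < cosheetMomentSum Ls hij * rectCharMoment Ls univ ↔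
      0 < rectCharMoment Ls (univ \ flatSheet Ls hij y₀) * rectCharMoment Ls univ := by
  have hcard : 0 < ((rectVortexSheet Ls i j hij).card : ℝ) :=
    Nat.cast_pos.2 (Finset.card_pos.2 ⟨_, origin_mem_rectVortexSheet Ls hij⟩)
  have hc : 0 < ((rectVortexSheet Ls i j hij).card : ℝ) * (2 : ℝ) ^ (Fintype.card (RectPlaquette Ls) - Ls i * Ls j) :=
    mul_pos hcard (pow_pos two_pos _)
  rw [cosheetMomentSum_eq_card_mul Ls hij y₀, ← mul_assoc, mul_assoc (_ * _), mul_pos_iff_of_pos_left hc]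

end Summit.Ventures.YMGap.Census

end
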